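import Mathlib
import Summits.ResolutionOfSingularities.ResolutionOfSingularities.Theorems.RadicialJungCleanModelsL7bGlobalCurveStep
import Literature.AlgebraicGeometry.Resolution.GenericPointStalkData
import Literature.AlgebraicGeometry.Resolution.SncStrata
import Literature.AlgebraicGeometry.Resolution.RsopLocalization
import HarnessLib

/-!
# Route `RadicialJung`, crux `CleanModels` (stmt-ResolutionOfSingularities-15917), line `Sketch` rev 35, stub 6 `stub_cleanProp44` (X44c):
# the ONE-DIMENSIONALITY DATA of a regular curve on a threefold stage, from the bound `dim 𝒪_{X,x} ≤ 3`

Memo `Cruxes/CleanModels/Lines/Sketch-memo-hand2-g10-stubs-5-7.md` §4 (i).  The L7b-global theorems (✓ `…_of_stage`, ✓ `…CurveStep`) take the curve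
`C₀ = cl{η}` with three pieces of dimension data: `dim 𝒪_{X,η} = 2`, the points of `C₀` other than `η` are CLOSED in `X`, and have `dim 𝒪_X = 3`.
On a stage all three follow from the regular-pair hypothesis `hC₀reg` and the bound `dim 𝒪_{X,x} ≤ 3` for all `x` (a threefold):
`curve_dimension_data`.  Proof: `𝓘_{C₀,y} = 𝔭_η` (the prime of the generisation `η ⤳ y`) has height `2` (regular pair ✓ `IsRsopPart.height_span_range`);
primes of generisations are ordered like the generisations (✓ `specializes_of_primeOfSpecializes_le`, Stacks 01J7), so `y ≠ η` gives
`𝔭_η < 𝔪_y`, `dim 𝒪_{X,y} ≥ 3`, and a further specialisation `y ⤳ z ≠ y` inside `C₀` would give `dim 𝒪_{X,z} ≥ 4`.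
Corollary: the curve-centre step of X_perm with these data discharged (`exists_isCleanRegularCentreBlowupSeq_blowup_strictTransform_of_stage'`).

Honest framing: OURS (bookkeeping); nothing here proves X44c or any case of `CleanModels`.
-/

noncomputable section

set_option linter.dupNamespace false -- mandated namespace of this single-conjunct summit

open CategoryTheory AlgebraicGeometry TopologicalSpace IsLocalRing Opposite
open Literature.AlgebraicGeometry.Resolution Literature.AlgebraicGeometry.Motives
open Scheme.IdealSheafData

namespace Summit.ResolutionOfSingularities.ResolutionOfSingularities.Theorems.RadicialJung.CleanModels

/-- **Dimension data of a regular curve on a threefold.**  See the module docstring. [cite: StacksProject, Tag 01J7] [cite: Matsumura1987, Thm. 14.2] -/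
theorem curve_dimension_data {X : Scheme.{0}} [IsLocallyNoetherian X] (hX3 : ∀ x : X, ringKrullDim (X.presheaf.stalk x) ≤ 3) {C₀ : Closeds X}
    (hC₀reg : ∀ y ∈ (C₀ : Set X), ∃ c : Fin 2 → X.presheaf.stalk y, IsRsopPart c ∧ Ideal.span (Set.range c) = stalkIdeal (vanishingIdeal C₀) y)
    {η : X} (hη : (C₀ : Set X) = closure {η}) :
    ringKrullDim (X.presheaf.stalk η) = 2 ∧ (∀ y ∈ (C₀ : Set X), y ≠ η → IsClosed ({y} : Set X)) ∧
      (∀ y ∈ (C₀ : Set X), y ≠ η → ringKrullDim (X.presheaf.stalk y) = 3) := by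
  have hC₀eq : C₀ = ⟨closure {η}, isClosed_closure⟩ := Closeds.ext hη
  have hηC : η ∈ (C₀ : Set X) := by rw [hη]; exact subset_closure rfl
  -- the ideal of `C₀` at a point `z ∈ C₀` is the prime of `η ⤳ z`, of height `2`
  have hIz : ∀ {z : X} (hz : η ⤳ z), stalkIdeal (vanishingIdeal C₀) z = primeOfSpecializes hz := fun hz => by
    have := stalkIdeal_vanishingIdeal_closure (X := X) hz
    rwa [← hC₀eq] at this
  have hht : ∀ {z : X} (hz : η ⤳ z), (primeOfSpecializes hz).height = 2 := by
    intro z hz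
    obtain ⟨c, hc, hspan⟩ := hC₀reg z (by rw [hη]; exact specializes_iff_mem_closure.mp hz)
    have h1 := hc.height_span_range
    rw [hspan, hIz hz] at h1
    exact_mod_cast h1
  -- distinct generisations have distinct primes (Stacks 01J7)
  have hlt : ∀ {z y : X} (hy : y ⤳ z) (hηy : η ⤳ y), y ≠ η → primeOfSpecializes (hηy.trans hy) < primeOfSpecializes hy := by
    intro z y hy hηy hne
    refine lt_of_le_of_ne (primeOfSpecializes_mono hy hηy) fun heq => hne ?_
    have h1 : y ⤳ η := specializes_of_primeOfSpecializes_le (hηy.trans hy) hy (le_of_eq heq.symm)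
    exact (h1.antisymm hηy).eq
  have hltmax : ∀ {z y : X} (hy : y ⤳ z), y ≠ z → primeOfSpecializes hy < maximalIdeal (X.presheaf.stalk z) := by
    intro z y hy hne
    rw [← primeOfSpecializes_refl z]
    refine lt_of_le_of_ne (primeOfSpecializes_mono (specializes_refl z) hy) fun heq => hne ?_
    have h1 : z ⤳ y := specializes_of_primeOfSpecializes_le hy (specializes_refl z) (le_of_eq heq.symm)
    exact (hy.antisymm h1).eq
  have hdim_le : ∀ z : X, (maximalIdeal (X.presheaf.stalk z)).height ≤ 3 := fun z => by
    have h1 : ((maximalIdeal (X.presheaf.stalk z)).height : WithBot ℕ∞) ≤ ((3 : ℕ∞) : WithBot ℕ∞) := by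
      rw [IsLocalRing.maximalIdeal_height_eq_ringKrullDim]; exact hX3 z
    exact WithBot.coe_le_coe.mp h1
  refine ⟨?_, ?_, ?_⟩
  · -- `dim 𝒪_η = 2`
    have h1 := hht (specializes_refl η)
    rw [primeOfSpecializes_refl] at h1
    rw [← IsLocalRing.maximalIdeal_height_eq_ringKrullDim, h1]; rfl
  · -- points other than `η` are closed
    intro y hyC hyη
    have hηy : η ⤳ y := by rw [specializes_iff_mem_closure, ← hη]; exact hyC
    refine isClosed_of_closure_subset fun z hz => ?_
    have hyz : y ⤳ z := specializes_iff_mem_closure.mpr hz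
    by_contra hzy
    have hzy' : y ≠ z := fun h => hzy (h ▸ rfl)
    have h1 : (primeOfSpecializes (hηy.trans hyz)).height + 1 ≤ (primeOfSpecializes hyz).height :=
      Ideal.height_add_one_le_of_lt_of_isPrime (hlt hyz hηy hyη)
    have h2 : (primeOfSpecializes hyz).height + 1 ≤ (maximalIdeal (X.presheaf.stalk z)).height :=
      Ideal.height_add_one_le_of_lt_of_isPrime (hltmax hyz hzy')
    rw [hht] at h1
    have h4 : (4 : ℕ∞) ≤ (maximalIdeal (X.presheaf.stalk z)).height :=
      calc (4 : ℕ∞) = 2 + 1 + 1 := by norm_num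
        _ ≤ (primeOfSpecializes hyz).height + 1 := add_le_add h1 le_rfl
        _ ≤ _ := h2
    exact absurd (h4.trans (hdim_le z)) (by decide)
  · -- `dim 𝒪_y = 3`
    intro y hyC hyη
    have hηy : η ⤳ y := by rw [specializes_iff_mem_closure, ← hη]; exact hyC
    refine le_antisymm (hX3 y) ?_
    have h1 : (primeOfSpecializes hηy).height + 1 ≤ (maximalIdeal (X.presheaf.stalk y)).height :=
      Ideal.height_add_one_le_of_lt_of_isPrime (hltmax hηy hyη.symm)
    rw [hht] at h1
    have h3 : (3 : ℕ∞) ≤ (maximalIdeal (X.presheaf.stalk y)).height := by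
      calc (3 : ℕ∞) = 2 + 1 := by norm_num
        _ ≤ _ := h1
    rw [← IsLocalRing.maximalIdeal_height_eq_ringKrullDim]
    exact (WithBot.coe_le_coe.mpr h3 : ((3 : ℕ∞) : WithBot ℕ∞) ≤ _)

/-- **The curve-centre step of X_perm on a threefold stage**, with the dimension data discharged by `curve_dimension_data`: `ρ : X → S` a stage of
`stub_cleanProp44` with `dim 𝒪_{X,x} ≤ 3` for all `x`, `C₀ = cl{η}` a regular curve (regular pair at each point, `η` not closed… i.e. `C₀ ≠ {η}` is
not required: if `C₀ = {η}` there is nothing one-dimensional to use) in the non-locally-principal locus of `J𝒪_X`.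
[cite: CossartPiltant2019, Prop. 4.4 (i)] [cite: CossartJannsenSaito2020, proof of Thm. 6.28, Step 5] -/
theorem exists_isCleanRegularCentreBlowupSeq_blowup_strictTransform_of_stage' (p : ℕ) [hp : Fact p.Prime] {S : Scheme.{0}}
    [IsIntegral S] [IsNoetherian S] [CharP S.functionField p] (hS : Scheme.IsRegular S) (hE : Scheme.IsExcellent S) (G₀ : S.functionField)
    (hG₀ : ∀ s : S, CleanRegAt p (algebraMap (S.presheaf.stalk s) S.functionField) G₀) {J : S.IdealSheafData}
    {X : Scheme.{0}} {ρ : X ⟶ S} [IsIntegral X] [IsNoetherian X] [IsDominant ρ] (hρ : IsCleanRegularCentreBlowupSeq p ρ J G₀)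
    (hX3 : ∀ x : X, ringKrullDim (X.presheaf.stalk x) ≤ 3) {C₀ : Closeds X}
    (hC₀reg : ∀ y ∈ (C₀ : Set X), ∃ c : Fin 2 → X.presheaf.stalk y,
      IsRsopPart c ∧ Ideal.span (Set.range c) = stalkIdeal (vanishingIdeal C₀) y)
    {η : X} (hη : (C₀ : Set X) = closure {η}) (hnp : ∀ y ∈ (C₀ : Set X), ¬ IsLocallyPrincipalAt (J.comap ρ) y) :
    ∃ (X' : Scheme.{0}) (_ : IsIntegral X') (_ : IsNoetherian X') (σ : X' ⟶ X) (_ : IsDominant σ) (C : Closeds X') (η' : X')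
      (X'' : Scheme.{0}) (_ : IsIntegral X'') (_ : IsNoetherian X'') (τ : X'' ⟶ X') (_ : IsDominant τ),
      (C : Set X') = closure {η'} ∧ σ η' = η ∧
      (∀ y ∈ (C : Set X'), ∃ c : Fin 2 → X'.presheaf.stalk y, IsRsopPart c ∧ Ideal.span (Set.range c) = stalkIdeal (vanishingIdeal C) y) ∧
      (∀ y ∈ (C : Set X'), CleanPermissibleAt p (RatFn.toFunctionField y) (RatFn.functionFieldMap (σ ≫ ρ) G₀) (stalkIdeal (vanishingIdeal C) y)) ∧
      IsBlowup τ (vanishingIdeal C) ∧ IsCleanRegularCentreBlowupSeq p (σ ≫ ρ) J G₀ ∧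
      IsCleanRegularCentreBlowupSeq p (τ ≫ σ ≫ ρ) J G₀ := by
  obtain ⟨hdimη, hcl, hdim3⟩ := curve_dimension_data hX3 hC₀reg hη
  exact exists_isCleanRegularCentreBlowupSeq_blowup_strictTransform_of_stage p hS hE G₀ hG₀ hρ hC₀reg hη hdimη hcl hdim3 hnp

end Summit.ResolutionOfSingularities.ResolutionOfSingularities.Theorems.RadicialJung.CleanModels

end
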